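/-
Copyright (c) 2026 the pub-hodgecm-mathlib formalisation cell (harness21).  Prover seat hodgecm-mathlib-LH7-p05 (g0), req620 Track A «(D-RAM) FOUR-FRAME» squad, helper lane on
h413 = stmt-HodgeConjecture-24833 (count-neutral).  β-BOARD v1 row R7 «GLUE CLASSES», Theorem C bricks L3a∕L3b∕L3d (ROADMAP-R7-TheoremC v1 d79581c1; sub-dealer LH4-p05 (g8)
ruling 15:31:23Z).  2026-09-04.
-/
import Summits.HodgeConjecture.HodgeConjecture.Theorems.F0P3cDyRamLabelledOddGluedRepClassSum   -- FILE 1 (this seat): §0 transversals, LEMMA A; brings ★ p860847, ★ PT-3, ★ κG-A1, ★ p13 read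
import HarnessLib

/-!
# Crux `H413`, line LH4 «(D-RAM) FOUR-FRAME» — (β) Stage B, β-BOARD row R7 Theorem C, bricks L3 (FILE 2 of 2): THE `a₀`-ELIMINATION AND THE HEAD
# `lOC_i(latt V(1,1,g)) ∕ [𝒰 : N(S̃)] = ω(D(g)_i) · stabiliserWeight · Σ_{aβ, aγ} ω(Y_i)·ω(g·g_α + ψ·g_β) ∕ (2·#Aβ·#Aγ)`

Cell `hodgecm-mathlib` (D-0151), FLOOR 0, crux item H413 = `stmt-HodgeConjecture-24833`, route `HCCMUnconditional`; squad F0∕P3c∕LH4 (β-table fan, sub-dealer LH4-p05 (g8)).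
THEOREMS ONLY (no `def`, no instance, no notation, no `sorry`, default heartbeats); ★-only imports; lane `--supports stmt-HodgeConjecture-24833 --as helper` (count-neutral);
pays NO row, states NO law.  ROADMAP-R7-TheoremC v1 d79581c1 bricks L3b∕L3d + HEAD over FILE 1's LEMMA A.  Consumer: the R7 Theorem C assembly (LH7-p05) after ★ p861389
(orbit decomposition) and ★-pending `GlueShellLinearisation` (LH7-p07); usable by any β-BOARD row on glued representatives.
* §2 LEMMA B `sum_productTransversal_classSign_eq` — with `A₀ = {1, c}` (`c` a fixed non-norm unit) the `a₀`-sum kills the «1» and doubles the label term: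
  `Σ_{r ∈ R₀} ω(r_i)(1 + ω(r₀ g g_α + r₁ g_β)) = 2·Σ_{aβ, aγ} ω(Y_i)·ω(g g_α + ψ g_β)`, `Y = (1, ψ, ψ·aβ)` (product re-indexing of `R₀`; `ω` multiplicative on fixed units).
* §3 HEAD `labelledOddCount_div_relIndex_glued_rep_eq` — dividing by `[𝒰 : N′]` with `#(R₀∩N′)·[𝒰 : N′] = #R₀·[𝒰 : S_F]` (FILE 1 §0 twice + `Subgroup.relIndex_mul_relIndex`)
  and `#R₀ = 2·#Aβ·#Aγ`; every constant is the SAME for all representatives `g` (★ B5 (iii)), which is what the R7 assembly needs (the target is `0`).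
HONEST LABEL: count-neutral bookkeeping; R7 C ∕ hRest ∕ (β-BAL) ∕ (β) ∕ T₊ OPEN; `HC_CM` is proved only modulo the 7 printed citations (2 remaining named inputs: hLiu418 =
`stmt-HodgeConjecture-24832`, h413 = `stmt-HodgeConjecture-24833`) until rung 0 closes.
References: [Kottwitz1986BaseChangeUnits] §1 pp. 240–241 · [LanglandsShelstad1987] §3 · [Rogawski1990] §4.9 Prop. 4.9.1 (a)(b) p. 55 · [Serre1979] Ch. V §3 Cor. 3.
-/

set_option autoImplicit false

noncomputable section

namespace Summit.HodgeConjecture.HodgeConjecture.Cruxes.H413.F0P3cDyRamLabelledOddGluedRepClassSumHead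


open Matrix WithZero
open Literature.NumberTheory.Automorphic Literature.NumberTheory.Automorphic.HermitianLattice Literature.NumberTheory.Automorphic.UnitaryGroup
open Literature.NumberTheory.Automorphic.UnitaryLatticeTree Literature.NumberTheory.Automorphic.UnitaryThreeFourFrame
open Literature.NumberTheory.LocalFields Literature.NumberTheory.LocalFields.WildQuadraticDatum
open Summit.HodgeConjecture.HodgeConjecture.Cruxes.H413.F0P3cDyRamFourFramePieces
open Summit.HodgeConjecture.HodgeConjecture.Cruxes.H413.F0P3cDyRamFourFrameCensusDefs
open Summit.HodgeConjecture.HodgeConjecture.Cruxes.H413.F0P3cDyRamDiagonalTorusDefs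
open Summit.HodgeConjecture.HodgeConjecture.Cruxes.H413.F0P3cDyRamLabelledOddCountDefs
open Summit.HodgeConjecture.HodgeConjecture.Cruxes.H413.F0P3cDyRamLabelledOddClassSignSubgroup (two_mul_card_mul_labelledOddCount_eq_sum_of_classSign)
open Summit.HodgeConjecture.HodgeConjecture.Cruxes.H413.F0P3cDyRamLabelledOddClassSignRead (label_mul_norm_iff_of_isTorusEquivariantLabel)
open Summit.HodgeConjecture.HodgeConjecture.Cruxes.H413.F0P3cDyRamLabelledOddOneSlotRead (map_unitNormMap_unitStabilizer_le)
open Summit.HodgeConjecture.HodgeConjecture.Cruxes.H413.F0P3cDyRamDiagonalLabelledOddOrbitCount (relIndex_map_unitNormMap_unitStabilizer_ne_zero)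
open Summit.HodgeConjecture.HodgeConjecture.Cruxes.H413.F0P3cDyRamTwoSlotLabelReadGlued (valueClassLabel_glued_rep_class_iff_normSign)
open Summit.HodgeConjecture.HodgeConjecture.Cruxes.H413.F0P3cDyRamDiagonalKappaGluedClassForm (isVertexLattice_zero_latt_glued_rep)
open Summit.HodgeConjecture.HodgeConjecture.Cruxes.H413.F0P3cDyRamDiagonalOrbitFibreTransport (fibre_isCoset_zero)
open Summit.HodgeConjecture.HodgeConjecture.Cruxes.H413.F0P3cDyRamValueClassLabelEquivariant (isTorusEquivariantLabel_valueClassLabel)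
open Summit.HodgeConjecture.HodgeConjecture.Cruxes.H413.F0P3cDyRamGluedDeepRatioSubgroup (exists_deepRatioSubgroup map_deepRatioSubgroup_le_map_unitStabilizer_glued_rep v_T_sub_one_le)
open Summit.HodgeConjecture.HodgeConjecture.Cruxes.H413.F0P3cDyRamGluedProductTransversal (productTransversal_glued_rep exists_productTransversal)
open Summit.HodgeConjecture.HodgeConjecture.Cruxes.H413.F0P3cDyRamDiagonalOrbitFibreCountHeads (finite_unitTorus_orbit_of_mem_normalisedStableLattices)
open Summit.HodgeConjecture.HodgeConjecture.Cruxes.H413.F0P3cDyRamStableCountTypeZero (v_diag_eq_one diag_regular)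
open Summit.HodgeConjecture.HodgeConjecture.Cruxes.H413.F0P3cDyRamDiagonalOrbitAveraging (relIndex_fixedUnitStabilizer_ne_zero_of_finite)
open scoped Valued WithZero Matrix MatrixGroups

variable {K : Type} [Field K] [Valued K ℤᵐ⁰]
open Summit.HodgeConjecture.HodgeConjecture.Cruxes.H413.F0P3cDyRamLabelledOddGluedRepClassSum

section Rep

variable [CompleteSpace K] [Fintype 𝓀[K]] {σ : K →+* K} {ϖ : K} {d t : ℕ} {α β : K} {N₀ n₁ n₂ n₃ : ℕ}
open Classical in
/-- **LEMMA B — THE `a₀`-ELIMINATION OVER `A₀ = {1, c}` AND THE PRODUCT RE-INDEXING**: for `R₀` parametrised by `{1,c} × Aβ × Aγ` (★ PT-3's letters; `c` a fixed non-norm unit),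
`Σ_{r ∈ R₀} ω(r_i)(1 + ω(r₀ g g_α + r₁ g_β)) = 2·Σ_{aβ ∈ Aβ} Σ_{aγ ∈ Aγ} ω(Y_i)·ω(g g_α + ψ g_β)`, `ψ = aγ·T(aβ)⁻¹`, `Y = (1, ψ, ψ·aβ)` (`ω` multiplicative on fixed
non-zero elements, `ω(c) = −1`). [cite: LanglandsShelstad1987, §3] [cite: Serre1979, Ch. V §3 Cor. 3] -/
theorem sum_productTransversal_classSign_eq (hD : IsRamifiedQuadraticDatum σ ϖ d t)
    {ρ t' : ℕ} (hρ : 1 ≤ ρ) {g : K} (hσg : σ g = g) (hg : Valued.v g = Valued.v ϖ ^ (2 * t'))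
    {gα gβ : K} (hσgα : σ gα = gα) (hσgβ : σ gβ = gβ)
    {c : K} (hσc : σ c = c) (hcv : Valued.v c = 1) (hc : ¬ ∃ z : K, z * σ z = c)
    (Aβ Aγ : Finset K)
    (hAγsub : ∀ a ∈ Aγ, σ a = a ∧ Valued.v (a - 1) ≤ Valued.v ϖ ^ (2 * ρ))
    (hAβsub : ∀ a ∈ Aβ, σ a = a ∧ Valued.v (a - 1) ≤ Valued.v ϖ ^ (ρ + 2 * t'))
    (hL : ∀ aβ ∈ Aβ, ∀ aγ ∈ Aγ, g * gα + aγ * (aβ + g⁻¹ * (aβ - 1))⁻¹ * gβ ≠ 0)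
    (R₀ : Finset (Fin 3 → Kˣ))
    (hR₀ : ∀ r : Fin 3 → Kˣ, r ∈ R₀ ↔ ∃ a₀ ∈ ({1, c} : Finset K), ∃ aβ ∈ Aβ, ∃ aγ ∈ Aγ,
      (r 0 : K) = a₀ ∧ (r 1 : K) = a₀ * (aγ * (aβ + g⁻¹ * (aβ - 1))⁻¹) ∧ (r 2 : K) = a₀ * (aγ * (aβ + g⁻¹ * (aβ - 1))⁻¹) * aβ)
    (i : Fin 3) :
    ∑ r ∈ R₀, normSign σ ((r i : Kˣ) : K) * (1 + normSign σ (((r 0 : Kˣ) : K) * g * gα + ((r 1 : Kˣ) : K) * gβ)) =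
      2 * ∑ aβ ∈ Aβ, ∑ aγ ∈ Aγ,
        normSign σ ((![(1 : K), aγ * (aβ + g⁻¹ * (aβ - 1))⁻¹, aγ * (aβ + g⁻¹ * (aβ - 1))⁻¹ * aβ] : Fin 3 → K) i) *
          normSign σ (g * gα + aγ * (aβ + g⁻¹ * (aβ - 1))⁻¹ * gβ) := by
  classical
  have hD' := hD
  obtain ⟨hσ, hvσ, hϖ, -, -, -, -⟩ := hD'
  have hϖ0 : ϖ ≠ 0 := fun h0 => by rw [h0, map_zero] at hϖ; exact WithZero.coe_ne_zero hϖ.symm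
  have hϖ1 : Valued.v ϖ < 1 := by rw [hϖ, ← WithZero.exp_zero, WithZero.exp_lt_exp]; norm_num
  have hc0 : c ≠ 0 := fun h => by rw [h, map_zero] at hcv; exact zero_ne_one hcv
  have h1c : (1 : K) ≠ c := fun h => hc ⟨1, by rw [map_one, one_mul, h]⟩
  have hωc : normSign σ c = -1 := normSign_of_not_isNorm σ hc
  have hg0 : g ≠ 0 := fun h => by
    rw [h, map_zero] at hg; exact (pow_ne_zero _ ((Valuation.ne_zero_iff Valued.v).2 hϖ0)) hg.symm
  -- letters: `T y = y + g⁻¹(y−1)`, `ψ = aγ·T(aβ)⁻¹`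
  have hTv : ∀ aβ ∈ Aβ, Valued.v (aβ + g⁻¹ * (aβ - 1)) = 1 := fun aβ haβ =>
    v_eq_one_of_v_sub_one_lt_one ((v_T_sub_one_le hϖ0 hϖ1.le ρ t' hg (hAβsub aβ haβ).2).trans_lt (pow_lt_one₀ zero_le hϖ1 (by omega)))
  have hT0 : ∀ aβ ∈ Aβ, aβ + g⁻¹ * (aβ - 1) ≠ 0 := fun aβ haβ h => by
    have := hTv aβ haβ; rw [h, map_zero] at this; exact zero_ne_one this
  have hσT : ∀ aβ ∈ Aβ, σ (aβ + g⁻¹ * (aβ - 1)) = aβ + g⁻¹ * (aβ - 1) := fun aβ haβ => by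
    rw [map_add, map_mul, map_inv₀, map_sub, map_one, hσg, (hAβsub aβ haβ).1]
  have hβv : ∀ aβ ∈ Aβ, Valued.v aβ = 1 := fun aβ haβ =>
    v_eq_one_of_v_sub_one_lt_one ((hAβsub aβ haβ).2.trans_lt (pow_lt_one₀ zero_le hϖ1 (by omega)))
  have hβ0 : ∀ aβ ∈ Aβ, aβ ≠ 0 := fun aβ haβ h => by have := hβv aβ haβ; rw [h, map_zero] at this; exact zero_ne_one this
  have hγv : ∀ aγ ∈ Aγ, Valued.v aγ = 1 := fun aγ haγ =>
    v_eq_one_of_v_sub_one_lt_one ((hAγsub aγ haγ).2.trans_lt (pow_lt_one₀ zero_le hϖ1 (by omega)))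
  have hγ0 : ∀ aγ ∈ Aγ, aγ ≠ 0 := fun aγ haγ h => by have := hγv aγ haγ; rw [h, map_zero] at this; exact zero_ne_one this
  -- the parametrisation `Φ (a₀, aβ, aγ)` as a unit vector
  let toU : K → Kˣ := fun x => if h : x = 0 then 1 else Units.mk0 x h
  have htoU : ∀ {x : K}, x ≠ 0 → ((toU x : Kˣ) : K) = x := fun {x} hx => by simp only [toU, dif_neg hx, Units.val_mk0]
  let Φ : K × (K × K) → (Fin 3 → Kˣ) := fun p => fun k =>
    toU ((![p.1, p.1 * (p.2.2 * (p.2.1 + g⁻¹ * (p.2.1 - 1))⁻¹), p.1 * (p.2.2 * (p.2.1 + g⁻¹ * (p.2.1 - 1))⁻¹) * p.2.1] : Fin 3 → K) k)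
  have hA₀0 : ∀ a₀ ∈ ({1, c} : Finset K), a₀ ≠ 0 ∧ σ a₀ = a₀ := fun a₀ ha₀ => by
    rcases Finset.mem_insert.1 ha₀ with rfl | h
    · exact ⟨one_ne_zero, map_one σ⟩
    · rw [Finset.mem_singleton.1 h]; exact ⟨hc0, hσc⟩
  -- components of `Φ`
  have hΦ : ∀ a₀ ∈ ({1, c} : Finset K), ∀ aβ ∈ Aβ, ∀ aγ ∈ Aγ,
      ((Φ (a₀, aβ, aγ) 0 : Kˣ) : K) = a₀ ∧ ((Φ (a₀, aβ, aγ) 1 : Kˣ) : K) = a₀ * (aγ * (aβ + g⁻¹ * (aβ - 1))⁻¹) ∧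
        ((Φ (a₀, aβ, aγ) 2 : Kˣ) : K) = a₀ * (aγ * (aβ + g⁻¹ * (aβ - 1))⁻¹) * aβ := by
    intro a₀ ha₀ aβ haβ aγ haγ
    have h0 := (hA₀0 a₀ ha₀).1
    have hψ0 : aγ * (aβ + g⁻¹ * (aβ - 1))⁻¹ ≠ 0 := mul_ne_zero (hγ0 aγ haγ) (inv_ne_zero (hT0 aβ haβ))
    refine ⟨?_, ?_, ?_⟩
    · show ((toU ((![_, _, _] : Fin 3 → K) 0) : Kˣ) : K) = _
      simp only [Matrix.cons_val_zero]; exact htoU h0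
    · show ((toU ((![_, _, _] : Fin 3 → K) 1) : Kˣ) : K) = _
      simp only [Matrix.cons_val_one, Matrix.cons_val_zero]; exact htoU (mul_ne_zero h0 hψ0)
    · show ((toU ((![_, _, _] : Fin 3 → K) 2) : Kˣ) : K) = _
      simp only [Matrix.cons_val_two, Matrix.tail_cons, Matrix.head_cons]
      exact htoU (mul_ne_zero (mul_ne_zero h0 hψ0) (hβ0 aβ haβ))
  -- `R₀` is the image of the product under `Φ`
  have hR₀eq : R₀ = (({1, c} : Finset K) ×ˢ (Aβ ×ˢ Aγ)).image Φ := by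
    ext r
    rw [hR₀, Finset.mem_image]
    constructor
    · rintro ⟨a₀, ha₀, aβ, haβ, aγ, haγ, h0, h1, h2⟩
      refine ⟨(a₀, aβ, aγ), Finset.mem_product.2 ⟨ha₀, Finset.mem_product.2 ⟨haβ, haγ⟩⟩, ?_⟩
      obtain ⟨e0, e1, e2⟩ := hΦ a₀ ha₀ aβ haβ aγ haγ
      funext k
      fin_cases k
      · exact Units.ext (e0.trans h0.symm)
      · exact Units.ext (e1.trans h1.symm)
      · exact Units.ext (e2.trans h2.symm)
    · rintro ⟨⟨a₀, aβ, aγ⟩, hp, rfl⟩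
      obtain ⟨ha₀, hq⟩ := Finset.mem_product.1 hp
      obtain ⟨haβ, haγ⟩ := Finset.mem_product.1 hq
      obtain ⟨e0, e1, e2⟩ := hΦ a₀ ha₀ aβ haβ aγ haγ
      exact ⟨a₀, ha₀, aβ, haβ, aγ, haγ, e0, e1, e2⟩
  have hinj : Set.InjOn Φ ((({1, c} : Finset K) ×ˢ (Aβ ×ˢ Aγ) : Finset (K × (K × K))) : Set (K × (K × K))) := by
    rintro ⟨a₀, aβ, aγ⟩ hp ⟨a₀', aβ', aγ'⟩ hp' h
    obtain ⟨ha₀, hq⟩ := Finset.mem_product.1 (Finset.mem_coe.1 hp)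
    obtain ⟨haβ, haγ⟩ := Finset.mem_product.1 hq
    obtain ⟨ha₀', hq'⟩ := Finset.mem_product.1 (Finset.mem_coe.1 hp')
    obtain ⟨haβ', haγ'⟩ := Finset.mem_product.1 hq'
    obtain ⟨e0, e1, e2⟩ := hΦ a₀ ha₀ aβ haβ aγ haγ
    obtain ⟨e0', e1', e2'⟩ := hΦ a₀' ha₀' aβ' haβ' aγ' haγ'
    have k0 : a₀ = a₀' := by rw [← e0, ← e0', h]
    have h0 := (hA₀0 a₀ ha₀).1
    have hψ0 : aγ * (aβ + g⁻¹ * (aβ - 1))⁻¹ ≠ 0 := mul_ne_zero (hγ0 aγ haγ) (inv_ne_zero (hT0 aβ haβ))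
    have k1 : aγ * (aβ + g⁻¹ * (aβ - 1))⁻¹ = aγ' * (aβ' + g⁻¹ * (aβ' - 1))⁻¹ := by
      have := e1.symm.trans ((congrArg (fun r : Fin 3 → Kˣ => ((r 1 : Kˣ) : K)) h).trans e1')
      rw [← k0] at this
      exact mul_left_cancel₀ h0 this
    have k2 : aβ = aβ' := by
      have := e2.symm.trans ((congrArg (fun r : Fin 3 → Kˣ => ((r 2 : Kˣ) : K)) h).trans e2')
      rw [← k0, ← k1] at this
      exact mul_left_cancel₀ (mul_ne_zero h0 hψ0) this
    have k3 : aγ = aγ' := by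
      rw [← k2] at k1
      exact mul_right_cancel₀ (inv_ne_zero (hT0 aβ haβ)) k1
    rw [k0, k2, k3]
  -- the letters `Y`, `L` per `(aβ, aγ)` and the value of the summand at `Φ (a₀, aβ, aγ)`
  have hval : ∀ a₀ ∈ ({1, c} : Finset K), ∀ aβ ∈ Aβ, ∀ aγ ∈ Aγ,
      normSign σ ((Φ (a₀, aβ, aγ) i : Kˣ) : K) * (1 + normSign σ (((Φ (a₀, aβ, aγ) 0 : Kˣ) : K) * g * gα + ((Φ (a₀, aβ, aγ) 1 : Kˣ) : K) * gβ)) =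
        normSign σ a₀ * normSign σ ((![(1 : K), aγ * (aβ + g⁻¹ * (aβ - 1))⁻¹, aγ * (aβ + g⁻¹ * (aβ - 1))⁻¹ * aβ] : Fin 3 → K) i) *
          (1 + normSign σ a₀ * normSign σ (g * gα + aγ * (aβ + g⁻¹ * (aβ - 1))⁻¹ * gβ)) := by
    intro a₀ ha₀ aβ haβ aγ haγ
    obtain ⟨h0, hσa₀⟩ := hA₀0 a₀ ha₀
    obtain ⟨e0, e1, e2⟩ := hΦ a₀ ha₀ aβ haβ aγ haγ
    have hψσ : σ (aγ * (aβ + g⁻¹ * (aβ - 1))⁻¹) = aγ * (aβ + g⁻¹ * (aβ - 1))⁻¹ := by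
      rw [map_mul, map_inv₀, (hAγsub aγ haγ).1, hσT aβ haβ]
    have hψ0 : aγ * (aβ + g⁻¹ * (aβ - 1))⁻¹ ≠ 0 := mul_ne_zero (hγ0 aγ haγ) (inv_ne_zero (hT0 aβ haβ))
    -- slot component `= a₀ · Y_i`
    have hYσ : σ ((![(1 : K), aγ * (aβ + g⁻¹ * (aβ - 1))⁻¹, aγ * (aβ + g⁻¹ * (aβ - 1))⁻¹ * aβ] : Fin 3 → K) i) =
        (![(1 : K), aγ * (aβ + g⁻¹ * (aβ - 1))⁻¹, aγ * (aβ + g⁻¹ * (aβ - 1))⁻¹ * aβ] : Fin 3 → K) i ∧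
        (![(1 : K), aγ * (aβ + g⁻¹ * (aβ - 1))⁻¹, aγ * (aβ + g⁻¹ * (aβ - 1))⁻¹ * aβ] : Fin 3 → K) i ≠ 0 ∧
        ((Φ (a₀, aβ, aγ) i : Kˣ) : K) = a₀ * (![(1 : K), aγ * (aβ + g⁻¹ * (aβ - 1))⁻¹, aγ * (aβ + g⁻¹ * (aβ - 1))⁻¹ * aβ] : Fin 3 → K) i := by
      fin_cases i
      · simp only [Fin.zero_eta, Fin.isValue, Matrix.cons_val_zero, map_one, mul_one]
        exact ⟨trivial, one_ne_zero, e0⟩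
      · simp only [Fin.mk_one, Fin.isValue, Matrix.cons_val_one, Matrix.cons_val_zero]
        exact ⟨hψσ, hψ0, e1⟩
      · simp only [Fin.reduceFinMk, Fin.isValue, Matrix.cons_val_two, Matrix.tail_cons, Matrix.head_cons]
        exact ⟨by rw [map_mul, hψσ, (hAβsub aβ haβ).1], mul_ne_zero hψ0 (hβ0 aβ haβ), by rw [e2, mul_assoc]⟩
    obtain ⟨hYσ', hY0, hcomp⟩ := hYσ
    have hLσ : σ (g * gα + aγ * (aβ + g⁻¹ * (aβ - 1))⁻¹ * gβ) = g * gα + aγ * (aβ + g⁻¹ * (aβ - 1))⁻¹ * gβ := by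
      rw [map_add, map_mul, map_mul, hσg, hσgα, hψσ, hσgβ]
    have hlin : ((Φ (a₀, aβ, aγ) 0 : Kˣ) : K) * g * gα + ((Φ (a₀, aβ, aγ) 1 : Kˣ) : K) * gβ =
        a₀ * (g * gα + aγ * (aβ + g⁻¹ * (aβ - 1))⁻¹ * gβ) := by rw [e0, e1]; ring
    rw [hcomp, hlin, normSign_mul_of_fixed hD hσa₀ hYσ' h0 hY0, normSign_mul_of_fixed hD hσa₀ hLσ h0 (hL aβ haβ aγ haγ)]
  have h1mem : (1 : K) ∈ ({1, c} : Finset K) := Finset.mem_insert_self _ _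
  have hcmem : c ∈ ({1, c} : Finset K) := Finset.mem_insert_of_mem (Finset.mem_singleton_self _)
  rw [hR₀eq, Finset.sum_image hinj, Finset.sum_product, Finset.sum_pair h1c, ← Finset.sum_add_distrib, Finset.sum_product,
    Finset.mul_sum]
  refine Finset.sum_congr rfl fun aβ haβ => ?_
  rw [Finset.mul_sum]
  refine Finset.sum_congr rfl fun aγ haγ => ?_
  rw [hval 1 h1mem aβ haβ aγ haγ, hval c hcmem aβ haβ aγ haγ, normSign_one, hωc]
  ring


open Classical in
/-- **HEAD — THE β-TABLE SUMMAND OF THE GLUED REPRESENTATIVE `latt V(1,1,g)` ON THE CLEAN SHELL, IN ★ PT-3's PRODUCT LETTERS**: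
`lOC_i(latt V) ∕ [𝒰 : N(S̃(latt V))] = ω(D(g)_i) · stabiliserWeight(latt V) ∕ (2·#Aβ·#Aγ) · Σ_{aβ, aγ} ω(Y_i)·ω(g·g_α + ψ·g_β)` — LEMMA A + LEMMA B + the index identity
`#(R₀∩N′)·[𝒰 : N′] = #R₀·[𝒰 : S_F]` (§0, `Subgroup.relIndex_mul_relIndex`), `#R₀ = 2·#Aβ·#Aγ` (★ `exists_productTransversal`).  `hL` = non-vanishing of the linear forms
(on the clean shell it follows from `|A| = |ϖ^{ℓ₀}|`, ★ `v_A_eq_of_one_le`; supplied by the assembler). [cite: Kottwitz1986BaseChangeUnits, §1 pp. 240–241]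
[cite: LanglandsShelstad1987, §3] [cite: Rogawski1990, §4.9 Prop. 4.9.1 (a)(b) p. 55] -/
theorem labelledOddCount_div_relIndex_glued_rep_eq (hD : IsRamifiedQuadraticDatum σ ϖ d t)
    {ρ t' : ℕ} (hρ : 1 ≤ ρ) (ht' : 1 ≤ t') {g : K} (hσg : σ g = g) (hg : Valued.v g = Valued.v ϖ ^ (2 * t'))
    (V : GL (Fin 3) K) (hV : (V : Matrix (Fin 3) (Fin 3) K) = !![1, 0, 0; 1, ϖ ^ ρ, 0; 1 * 1 + g, ϖ ^ ρ * 1, ϖ ^ (2 * ρ + 2 * t')])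
    (hn : IsNormalisedLattice (latt (V : Matrix (Fin 3) (Fin 3) K)))
    (hE : IsElementDatum σ ϖ N₀ α β n₁ n₂ n₃) {mc : ℕ} (hℓN : d % 2 + 1 ≤ N₀) (hmN : d % 2 + 2 * d - 1 ≤ N₀)
    (hℓmc : 2 * (d % 2) + 1 ≤ mc) (hmmc : d % 2 + 2 * d - 1 + d % 2 ≤ mc)
    (hlev : LatticeInLevel ϖ (d % 2) (Matrix.diagonal ![α - 1, β - 1, 0]) (latt (V : Matrix (Fin 3) (Fin 3) K)))
    (hnlev : ¬ LatticeInLevel ϖ (d % 2 + 1) (Matrix.diagonal ![α - 1, β - 1, 0]) (latt (V : Matrix (Fin 3) (Fin 3) K)))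
    (hsq : LatticeInLevel ϖ mc (Matrix.diagonal ![(α - 1) * (α - 1), (β - 1) * (β - 1), 0]) (latt (V : Matrix (Fin 3) (Fin 3) K)))
    {T : GL (Fin 3) K} (hT : (T : Matrix (Fin 3) (Fin 3) K) = Matrix.diagonal ![α, β, 1])
    (hTM : mapGL T (latt (V : Matrix (Fin 3) (Fin 3) K)) = latt (V : Matrix (Fin 3) (Fin 3) K))
    {gα gβ : K} (hσgα : σ gα = gα) (hσgβ : σ gβ = gβ)
    (hgα : Valued.v ((ϖ ^ (d % 2 + 2 * d - 1))⁻¹ * (((ϖ * σ ϖ) ^ (ρ + t'))⁻¹ * g * ((α - 1) - gα * ((ϖ - σ ϖ) * ((ϖ * σ ϖ) ^ ((d - d % 2) / 2))⁻¹)))) ≤ 1)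
    (hgβ : Valued.v ((ϖ ^ (d % 2 + 2 * d - 1))⁻¹ * (((ϖ * σ ϖ) ^ (ρ + t'))⁻¹ * ((β - 1) - gβ * ((ϖ - σ ϖ) * ((ϖ * σ ϖ) ^ ((d - d % 2) / 2))⁻¹)))) ≤ 1)
    (Aβ Aγ : Finset K)
    (hAγsub : ∀ a ∈ Aγ, σ a = a ∧ Valued.v (a - 1) ≤ Valued.v ϖ ^ (2 * ρ))
    (hAγ : ∀ p : K, σ p = p → Valued.v (p - 1) ≤ Valued.v ϖ ^ (2 * ρ) →
      ∃! a, a ∈ Aγ ∧ ∃ w : K, Valued.v (w - 1) ≤ Valued.v ϖ ^ (2 * ρ) ∧ w * σ w = a / p)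
    (hAβsub : ∀ a ∈ Aβ, σ a = a ∧ Valued.v (a - 1) ≤ Valued.v ϖ ^ (ρ + 2 * t'))
    (hAβ : ∀ y : K, σ y = y → Valued.v (y - 1) ≤ Valued.v ϖ ^ (ρ + 2 * t') →
      ∃! a, a ∈ Aβ ∧ ∃ s : K, Valued.v (s - 1) ≤ Valued.v ϖ ^ (2 * ρ + 2 * t') ∧ s * σ s = a / y)
    (hL : ∀ aβ ∈ Aβ, ∀ aγ ∈ Aγ, g * gα + aγ * (aβ + g⁻¹ * (aβ - 1))⁻¹ * gβ ≠ 0)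
    (i : Fin 3) :
    (labelledOddCount σ ϖ 0 i (valueClassLabel σ ϖ (α - 1) (β - 1) (d % 2 + 2 * d - 1) d) (latt (V : Matrix (Fin 3) (Fin 3) K)) : ℚ) /
        ((((unitStabilizer (latt (V : Matrix (Fin 3) (Fin 3) K))).map (unitNormMap σ 3)).relIndex (fixedUnitTorus σ 3) : ℕ) : ℚ) =
      (normSign σ ((![((ϖ * σ ϖ) ^ (ρ + t'))⁻¹ * g, ((ϖ * σ ϖ) ^ (ρ + t'))⁻¹, -(((ϖ * σ ϖ) ^ (ρ + t'))⁻¹ * (1 + g)⁻¹)] : Fin 3 → K) i) : ℚ) *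
        stabiliserWeight σ (latt (V : Matrix (Fin 3) (Fin 3) K)) / (2 * (Aβ.card : ℚ) * (Aγ.card : ℚ)) *
        ((∑ aβ ∈ Aβ, ∑ aγ ∈ Aγ,
          normSign σ ((![(1 : K), aγ * (aβ + g⁻¹ * (aβ - 1))⁻¹, aγ * (aβ + g⁻¹ * (aβ - 1))⁻¹ * aβ] : Fin 3 → K) i) *
            normSign σ (g * gα + aγ * (aβ + g⁻¹ * (aβ - 1))⁻¹ * gβ) : ℤ) : ℚ) := by
  classical
  have hD' := hD
  obtain ⟨hσ, hvσ, hϖ, -, -, -, -⟩ := hD'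
  haveI := Literature.NumberTheory.LocalFields.isAdicComplete_valuedInteger_of_completeSpace hϖ
  have hϖ0 : ϖ ≠ 0 := fun h0 => by rw [h0, map_zero] at hϖ; exact WithZero.coe_ne_zero hϖ.symm
  have hϖ1 : Valued.v ϖ < 1 := by rw [hϖ, ← WithZero.exp_zero, WithZero.exp_lt_exp]; norm_num
  obtain ⟨c, hσc, hcv, hc, hdich⟩ := exists_nonnorm_dichotomy_of_isRamifiedQuadraticDatum σ ϖ d t hD
  have hc0 : c ≠ 0 := fun h => by rw [h, map_zero] at hcv; exact zero_ne_one hcv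
  have h1c : (1 : K) ≠ c := fun h => hc ⟨1, by rw [map_one, one_mul, h]⟩
  -- `|z| = 1` when `z·σz` is a unit
  have hunit : ∀ {z w : K}, z * σ z = w → Valued.v w = 1 → Valued.v z = 1 := by
    intro z w hz hw
    have h2 : Valued.v z * Valued.v z = 1 := by
      have := congrArg Valued.v hz
      rwa [map_mul, hvσ, hw] at this
    have h2' : Valued.v z ^ 2 = 1 := by rw [sq]; exact h2
    exact (pow_eq_one_iff.1 h2').resolve_right (by norm_num)
  -- `A₀ = {1, c}` is an ∃!-system of the fixed units modulo unit norms
  have hA₀sub : ∀ a ∈ ({1, c} : Finset K), σ a = a ∧ Valued.v a = 1 := fun a ha => by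
    rcases Finset.mem_insert.1 ha with rfl | h
    · exact ⟨map_one σ, map_one _⟩
    · rw [Finset.mem_singleton.1 h]; exact ⟨hσc, hcv⟩
  have h1mem : (1 : K) ∈ ({1, c} : Finset K) := Finset.mem_insert_self _ _
  have hcmem : c ∈ ({1, c} : Finset K) := Finset.mem_insert_of_mem (Finset.mem_singleton_self _)
  have hA₀ : ∀ x : K, σ x = x → Valued.v x = 1 → ∃! a, a ∈ ({1, c} : Finset K) ∧ ∃ e : K, Valued.v e = 1 ∧ e * σ e = a / x := by
    intro x hσx hvx
    have hx0 : x ≠ 0 := fun h => by rw [h, map_zero] at hvx; exact zero_ne_one hvx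
    -- no element can be represented by both `1` and `c`
    have hexcl : ∀ e e' : K, e * σ e = 1 / x → e' * σ e' = c / x → False := by
      intro e e' he he'
      have he0 : e ≠ 0 := fun h => by
        rw [h, zero_mul] at he; exact div_ne_zero one_ne_zero hx0 he.symm
      apply hc
      refine ⟨e' / e, ?_⟩
      rw [map_div₀, div_mul_div_comm, he, he']
      field_simp
    rcases hdich x hσx hx0 with ⟨z, hz⟩ | ⟨z, hz⟩
    · have hz1 : Valued.v z = 1 := hunit hz hvx
      have hz0 : z ≠ 0 := fun h => by rw [h, map_zero] at hz1; exact zero_ne_one hz1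
      refine ⟨1, ⟨h1mem, z⁻¹, by rw [map_inv₀, hz1, inv_one], by rw [map_inv₀, ← mul_inv, hz, one_div]⟩, ?_⟩
      rintro a ⟨ha, e, -, he⟩
      rcases Finset.mem_insert.1 ha with rfl | h
      · rfl
      · rw [Finset.mem_singleton.1 h] at he
        exact (hexcl z⁻¹ e (by rw [map_inv₀, ← mul_inv, hz, one_div]) he).elim
    · have hcx : Valued.v (c * x) = 1 := by rw [map_mul, hcv, hvx, one_mul]
      have hz1 : Valued.v z = 1 := hunit hz hcx
      refine ⟨c, ⟨hcmem, z / x, by rw [map_div₀, hz1, hvx, div_one], ?_⟩, ?_⟩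
      · rw [map_div₀, hσx, div_mul_div_comm, hz]
        field_simp
      · rintro a ⟨ha, e, -, he⟩
        rcases Finset.mem_insert.1 ha with rfl | h
        · exact (hexcl e (z / x) he (by rw [map_div₀, hσx, div_mul_div_comm, hz]; field_simp)).elim
        · exact (Finset.mem_singleton.1 h).symm ▸ rfl
  -- polarisation data of the representative (★ κG-A1) and `N′ ≤ S_F`
  have hσϖ0 : σ ϖ ≠ 0 := (map_ne_zero σ).2 hϖ0
  have hπ0 : ((ϖ * σ ϖ) ^ (ρ + t') : K) ≠ 0 := pow_ne_zero _ (mul_ne_zero hϖ0 hσϖ0)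
  have hσπ : σ ((ϖ * σ ϖ) ^ (ρ + t')) = (ϖ * σ ϖ) ^ (ρ + t') := by rw [map_pow, map_mul, hσ, mul_comm]
  have hg1 : Valued.v g < 1 := by rw [hg]; exact pow_lt_one₀ zero_le hϖ1 (by omega)
  have hg0 : g ≠ 0 := fun h => by
    rw [h, map_zero] at hg; exact (pow_ne_zero _ ((Valuation.ne_zero_iff Valued.v).2 hϖ0)) hg.symm
  have h1g : Valued.v (1 + g) = 1 := Valued.v.map_one_add_of_lt hg1
  have h1g0 : 1 + g ≠ 0 := fun h => by rw [h, map_zero] at h1g; exact zero_ne_one h1g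
  have hV₁ := isVertexLattice_zero_latt_glued_rep hσ hvσ hϖ0 hϖ1 ρ t' hσg hg ht' V hV
  have hD₁ := glued_rep_polarisation_fixed_ne_zero hσ hϖ0 ρ t' hσg hg0 h1g0
  have hcoset := fun D hD => fibre_isCoset_zero hvσ ϖ V rfl hn _ hD₁ hV₁ D hD
  have hN'S : (unitStabilizer (latt (V : Matrix (Fin 3) (Fin 3) K))).map (unitNormMap σ 3) ≤ fixedUnitStabilizer σ (latt (V : Matrix (Fin 3) (Fin 3) K)) :=
    map_unitNormMap_unitStabilizer_le σ hσ ϖ 0 hD₁ hV₁ hcoset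
  have hSU : fixedUnitStabilizer σ (latt (V : Matrix (Fin 3) (Fin 3) K)) ≤ fixedUnitTorus σ 3 :=
    fun u hu => (mem_fixedUnitTorus_iff σ u).2 ((mem_fixedUnitStabilizer_iff σ _ u).1 hu).2
  have hfinOrb : {M : Submodule 𝒪[K] (Fin 3 → K) | ∃ u ∈ unitTorus K 3, M = mapGL (diagGLUnits u) (latt (V : Matrix (Fin 3) (Fin 3) K))}.Finite :=
    finite_unitTorus_orbit_of_mem_normalisedStableLattices hϖ (v_diag_eq_one hvσ hE) (diag_regular hE) T hT ⟨⟨V, rfl⟩, hTM, hn⟩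
  have hUN := relIndex_map_unitNormMap_unitStabilizer_ne_zero hσ hvσ hσc hcv hc hdich hfinOrb
  have hSF0 := relIndex_fixedUnitStabilizer_ne_zero_of_finite σ hfinOrb
  -- the product subgroup, the product transversal, LEMMA A and LEMMA B
  obtain ⟨Dρ, hDρ⟩ := exists_deepRatioSubgroup (K := K) ϖ ρ t'
  have hN₀N' := map_deepRatioSubgroup_le_map_unitStabilizer_glued_rep σ hϖ0 hϖ1.le ρ t' hg V hV hDρ
  obtain ⟨R₀, hR₀, hR₀card⟩ := exists_productTransversal hϖ0 hϖ1 hρ hg ({1, c} : Finset K) Aβ Aγ (fun a ha => (hA₀sub a ha).2)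
    (fun a ha => (hAγsub a ha).2) (fun a ha => (hAβsub a ha).2)
  obtain ⟨hR₀S, hR₀T⟩ := productTransversal_glued_rep hvσ hϖ0 hϖ1 hρ hσg hg V hV hDρ ({1, c} : Finset K) Aβ Aγ hA₀sub hA₀ hAγsub hAγ
    hAβsub hAβ R₀ hR₀
  have hA := two_mul_card_mul_labelledOddCount_glued_rep_eq_sum hD hρ ht' hσg hg V hV hn hE hℓN hmN hℓmc hmmc hlev hnlev hsq hT hTM hσgα hσgβ
    hgα hgβ hσc hcv hc hdich ({1, c} : Finset K) Aβ Aγ hA₀sub hA₀ hAγsub hAγ hAβsub hAβ R₀ hR₀ hDρ i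
  have hB := sum_productTransversal_classSign_eq hD hρ hσg hg hσgα hσgβ hσc hcv hc Aβ Aγ hAγsub hAβsub hL R₀ hR₀ i
  rw [hB] at hA
  -- cardinalities: `#(R₀ ∩ N′)·[𝒰 : N′] = #R₀·[𝒰 : S_F]`
  have hc1 : (R₀.filter fun r => r ∈ (unitStabilizer (latt (V : Matrix (Fin 3) (Fin 3) K))).map (unitNormMap σ 3)).card =
      (Dρ.map (unitNormMap σ 3)).relIndex ((unitStabilizer (latt (V : Matrix (Fin 3) (Fin 3) K))).map (unitNormMap σ 3)) := by
    refine card_eq_relIndex_of_transversal _ (fun r hr => (Finset.mem_filter.1 hr).2) (fun u hu => ?_)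
    obtain ⟨r, ⟨hr, hur⟩, huniq⟩ := hR₀T u (hN'S hu)
    refine ⟨r, ⟨Finset.mem_filter.2 ⟨hr, ?_⟩, hur⟩, fun r' hr' => huniq r' ⟨(Finset.mem_filter.1 hr'.1).1, hr'.2⟩⟩
    have e : r = u * (u⁻¹ * r) := by rw [mul_inv_cancel_left]
    rw [e]
    exact mul_mem hu (hN₀N' hur)
  have hc2 : R₀.card = (Dρ.map (unitNormMap σ 3)).relIndex (fixedUnitStabilizer σ (latt (V : Matrix (Fin 3) (Fin 3) K))) :=
    card_eq_relIndex_of_transversal R₀ hR₀S hR₀T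
  have ht1 := Subgroup.relIndex_mul_relIndex _ _ _ hN₀N' (hN'S.trans hSU)
  have ht2 := Subgroup.relIndex_mul_relIndex _ _ _ (hN₀N'.trans hN'S) hSU
  have hkey : (R₀.filter fun r => r ∈ (unitStabilizer (latt (V : Matrix (Fin 3) (Fin 3) K))).map (unitNormMap σ 3)).card *
      ((unitStabilizer (latt (V : Matrix (Fin 3) (Fin 3) K))).map (unitNormMap σ 3)).relIndex (fixedUnitTorus σ 3) =
      R₀.card * (fixedUnitStabilizer σ (latt (V : Matrix (Fin 3) (Fin 3) K))).relIndex (fixedUnitTorus σ 3) := by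
    rw [hc1, hc2, ht1, ht2]
  have h2card : ({1, c} : Finset K).card = 2 := Finset.card_pair h1c
  rw [h2card] at hR₀card
  have hAβne : Aβ.card ≠ 0 := by
    obtain ⟨a, ⟨ha, -⟩, -⟩ := hAβ 1 (map_one σ) (by rw [sub_self, map_zero]; exact zero_le)
    exact Finset.card_ne_zero_of_mem ha
  have hAγne : Aγ.card ≠ 0 := by
    obtain ⟨a, ⟨ha, -⟩, -⟩ := hAγ 1 (map_one σ) (by rw [sub_self, map_zero]; exact zero_le)
    exact Finset.card_ne_zero_of_mem ha
  -- to `ℚ`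
  have hAq : (2 : ℚ) * ((R₀.filter fun r => r ∈ (unitStabilizer (latt (V : Matrix (Fin 3) (Fin 3) K))).map (unitNormMap σ 3)).card : ℚ) *
      (labelledOddCount σ ϖ 0 i (valueClassLabel σ ϖ (α - 1) (β - 1) (d % 2 + 2 * d - 1) d) (latt (V : Matrix (Fin 3) (Fin 3) K)) : ℚ) =
      (normSign σ ((![((ϖ * σ ϖ) ^ (ρ + t'))⁻¹ * g, ((ϖ * σ ϖ) ^ (ρ + t'))⁻¹, -(((ϖ * σ ϖ) ^ (ρ + t'))⁻¹ * (1 + g)⁻¹)] : Fin 3 → K) i) : ℚ) *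
        (2 * ((∑ aβ ∈ Aβ, ∑ aγ ∈ Aγ,
          normSign σ ((![(1 : K), aγ * (aβ + g⁻¹ * (aβ - 1))⁻¹, aγ * (aβ + g⁻¹ * (aβ - 1))⁻¹ * aβ] : Fin 3 → K) i) *
            normSign σ (g * gα + aγ * (aβ + g⁻¹ * (aβ - 1))⁻¹ * gβ) : ℤ) : ℚ)) := by
    exact_mod_cast hA
  have hkeyq : ((R₀.filter fun r => r ∈ (unitStabilizer (latt (V : Matrix (Fin 3) (Fin 3) K))).map (unitNormMap σ 3)).card : ℚ) *
      ((((unitStabilizer (latt (V : Matrix (Fin 3) (Fin 3) K))).map (unitNormMap σ 3)).relIndex (fixedUnitTorus σ 3) : ℕ) : ℚ) =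
      (2 * (Aβ.card : ℚ) * (Aγ.card : ℚ)) * (((fixedUnitStabilizer σ (latt (V : Matrix (Fin 3) (Fin 3) K))).relIndex (fixedUnitTorus σ 3) : ℕ) : ℚ) := by
    have := hkey
    rw [hR₀card] at this
    exact_mod_cast this
  have hUNq : ((((unitStabilizer (latt (V : Matrix (Fin 3) (Fin 3) K))).map (unitNormMap σ 3)).relIndex (fixedUnitTorus σ 3) : ℕ) : ℚ) ≠ 0 :=
    Nat.cast_ne_zero.2 hUN
  have hSFq : (((fixedUnitStabilizer σ (latt (V : Matrix (Fin 3) (Fin 3) K))).relIndex (fixedUnitTorus σ 3) : ℕ) : ℚ) ≠ 0 :=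
    Nat.cast_ne_zero.2 hSF0
  have hAβq : (Aβ.card : ℚ) ≠ 0 := Nat.cast_ne_zero.2 hAβne
  have hAγq : (Aγ.card : ℚ) ≠ 0 := Nat.cast_ne_zero.2 hAγne
  have hkq : ((R₀.filter fun r => r ∈ (unitStabilizer (latt (V : Matrix (Fin 3) (Fin 3) K))).map (unitNormMap σ 3)).card : ℚ) ≠ 0 := by
    intro h0
    rw [h0, zero_mul] at hkeyq
    exact (mul_ne_zero (mul_ne_zero (mul_ne_zero two_ne_zero hAβq) hAγq) hSFq) hkeyq.symm
  rw [stabiliserWeight]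
  generalize (labelledOddCount σ ϖ 0 i (valueClassLabel σ ϖ (α - 1) (β - 1) (d % 2 + 2 * d - 1) d) (latt (V : Matrix (Fin 3) (Fin 3) K)) : ℚ) = Lq at hAq ⊢
  generalize (normSign σ ((![((ϖ * σ ϖ) ^ (ρ + t'))⁻¹ * g, ((ϖ * σ ϖ) ^ (ρ + t'))⁻¹, -(((ϖ * σ ϖ) ^ (ρ + t'))⁻¹ * (1 + g)⁻¹)] : Fin 3 → K) i) : ℚ) = ωq at hAq ⊢
  generalize ((∑ aβ ∈ Aβ, ∑ aγ ∈ Aγ,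
          normSign σ ((![(1 : K), aγ * (aβ + g⁻¹ * (aβ - 1))⁻¹, aγ * (aβ + g⁻¹ * (aβ - 1))⁻¹ * aβ] : Fin 3 → K) i) *
            normSign σ (g * gα + aγ * (aβ + g⁻¹ * (aβ - 1))⁻¹ * gβ) : ℤ) : ℚ) = Sq at hAq ⊢
  generalize ((R₀.filter fun r => r ∈ (unitStabilizer (latt (V : Matrix (Fin 3) (Fin 3) K))).map (unitNormMap σ 3)).card : ℚ) = kq at hAq hkeyq hkq
  generalize ((((unitStabilizer (latt (V : Matrix (Fin 3) (Fin 3) K))).map (unitNormMap σ 3)).relIndex (fixedUnitTorus σ 3) : ℕ) : ℚ) = NU at hkeyq hUNq ⊢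
  generalize (((fixedUnitStabilizer σ (latt (V : Matrix (Fin 3) (Fin 3) K))).relIndex (fixedUnitTorus σ 3) : ℕ) : ℚ) = SFU at hkeyq hSFq ⊢
  generalize (Aβ.card : ℚ) = nβ at hkeyq hAβq ⊢
  generalize (Aγ.card : ℚ) = nγ at hkeyq hAγq ⊢
  rw [div_eq_iff hUNq]
  field_simp
  linear_combination (NU / 2) * hAq - Lq * hkeyq

end Rep

end Summit.HodgeConjecture.HodgeConjecture.Cruxes.H413.F0P3cDyRamLabelledOddGluedRepClassSumHead

end
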